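import Summits.BirchSwinnertonDyer.BirchSwinnertonDyer.Theorems.SignedLowerHalvesSmallImageLowerHalfBothSignsLambdaLowerThreeNsThetaPartnerTraceCongruence
import Summits.BirchSwinnertonDyer.BirchSwinnertonDyer.Theorems.SignedLowerHalvesSmallImageLowerHalfBothSignsLambdaLowerThreeNsThetaPartnerPlaces
import Literature.NumberTheory.GaloisRepresentations.TeichmullerLiftMonomial
import Literature.NumberTheory.GaloisRepresentations.IntegralGaloisActionProofs
import Literature.NumberTheory.GaloisRepresentations.RestrictFieldSemisimple
import Literature.NumberTheory.GaloisRepresentations.ArtinFormalismInductionProofs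
import Literature.NumberTheory.EllipticCurves.SupersingularDensitySerreTraceProofs
import Literature.FieldTheory.AlgClosed.PadicAlgClEquivComplex
import HarnessLib

/-!
# `η̃((ℓ)) ≡ (d_K/ℓ)·ℓ (mod 𝔪_{ℤ̄_p})`: the Frobenius values on a rational prime (brick R4b of the odd-`p` theta partner)

Route `SignedLowerHalves`, child L `SmallImageLowerHalfBothSigns` (item stmt-BirchSwinnertonDyer-23599), line
proposal `rtt_w3`, stub K0₂@p `stub_heckeThetaPartner_ns` — brick R4b ("Frobenius values on `(ℓ)`") of the arithmetic
half at an ODD prime (width seat `bsd-line-slh-p3-w3` gen 9; memo `Lines/birth_acns-MEMO-w3-g9.md`).  THEOREMS ONLY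
(no definition, no named fact, no `sorry`); ROUTE-INDEPENDENT.

Setting as in `…ThetaPartnerTraceCongruence` (frame `Φ`, field `k ⊆ M₂(𝔽_p)` of degree `2` normalised by the image
of `ρ̄ = ρ̄_{E,p}`, `U = ρ̄⁻¹(kˣ) = res(Γ_K)` for the quadratic Galois field `K`, `j : k →+* 𝔽̄_p`, `e : ℚ̄_p ≃ ℂ`,
Teichmüller section `T`, and a function `χᵥ` on the places of `K` with `χᵥ(w) = e(T(j(Φρ̄(res Frob_w))))` at the
`w ∣ ℓ`), plus a coordinate frame `E[p] ≃ 𝔽_p²` for `Φ` (to read determinants).  For an odd good prime `ℓ ≠ p` of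
`E` with `ℓ ∤ d_K`:

  `‖e⁻¹(χ̃ᵥ((ℓ))) − (d_K/ℓ)·ℓ‖ < 1`, `χ̃ᵥ((ℓ)) = ∏_{w ∣ ℓ} χᵥ(w)`  (`norm_symm_idealPow_span_prime_sub_lt_one`):

* `Frob_ℓ ∈ U`: `(ℓ) = w₀ w₁` splits (two places, `…FrobeniusPlaces.exists_places_split_of_mem_range`), so
  `(d_K/ℓ) = 1` (`KroneckerSplitting.ncard_primesOver_eq_two_iff_jacobiSym`), and `χᵥ(w₀)χᵥ(w₁) ≡ j(y ȳ) =
  j(det y) = ℓ` for `y = Φρ̄(Frob_ℓ) ∈ k` (`mul_conj_eq_det_smul_one`, `…ThetaPartnerFrame.det_frob_eq`);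
* `Frob_ℓ ∉ U`: `(ℓ) = w` is inert, `(d_K/ℓ) = −1`, `Frob_w` restricts to `Frob_ℓ²` and
  `Φρ̄(Frob_ℓ²) = −ℓ·1` (`…ThetaPartnerFrame.frob_sq_eq_neg_smul_one_of_not_mem`).

The `ℤ`/`𝓞 ℚ` dictionary for places of `K` above `ℓ` is `…ThetaPartnerPlaces`.  This is the input "trivial Nebentypus on primes" of brick R4 (`…ThetaPartnerNebentypus`).  BSD, crux L and the stub
are NOT proved here.

References: J.-P. Serre, Invent. Math. 15 (1972) §2.2; K. Ribet, LNM 601 (1977) §3 (p. 35); D. A. Marcus, *Number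
Fields*, Ch. 3 Thm. 25; J. Neukirch, ANT I §8–§9, III (2.12).
-/

set_option autoImplicit false
set_option linter.dupNamespace false

noncomputable section

open scoped Classical NumberField MatrixGroups
open IsDedekindDomain Field Matrix NumberField WeierstrassCurve Literature.NumberTheory.EllipticCurves
  Literature.NumberTheory.GaloisRepresentations Rat.HeightOneSpectrum
  Literature.NumberTheory.EllipticCurves.Rank1Residual UniqueFactorizationMonoid
  Literature.NumberTheory.LFunctions

namespace Summit.BirchSwinnertonDyer.BirchSwinnertonDyer.Theorems.SmallImageLambdaLowerThreeNsThetaPartner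

/-! ### §1. `GL₂(F)`: `y ȳ = det y` -/

section GL2

variable {F : Type*} [Field F]

/-- For `n ∈ N(kˣ) ∖ kˣ` and `y ∈ k`: `y · (n y n⁻¹) = y ȳ = det(y)·1` (Cayley–Hamilton with `n y n⁻¹ = tr(y)·1 − y`).
[cite: Serre1972, §2.2] -/
theorem mul_conj_eq_det_smul_one {k : Subalgebra F (Matrix (Fin 2) (Fin 2) F)} (hk : IsField k)
    {y : Matrix (Fin 2) (Fin 2) F} (hy : y ∈ k) {n : GL (Fin 2) F}
    (hn : n ∈ Subgroup.normalizer (Serre1972.unitGroup k : Set (GL (Fin 2) F)))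
    (hnC : n ∉ Serre1972.unitGroup k) :
    y * ((n : Matrix (Fin 2) (Fin 2) F) * y * (n : Matrix (Fin 2) (Fin 2) F)⁻¹) = y.det • 1 := by
  rw [conj_eq_trace_smul_one_sub hk hy hn hnC, mul_sub, mul_smul_comm, mul_one, sq_eq_trace_smul_sub_det_smul,
    sub_sub_cancel]

end GL2

/-! ### §2. On `E[p]`: the product of the two Frobenius values at a split prime -/

section Curve

variable (W : WeierstrassCurve ℚ) [W.IsElliptic] [W.IsGloballyMinimal] (p : ℕ) [Fact p.Prime]
  (Φ : Multiplicative (AddAut (geomTorsion W p)) ≃* GL (Fin 2) (ZMod p))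
  {k : Subalgebra (ZMod p) (Matrix (Fin 2) (Fin 2) (ZMod p))}

omit [W.IsGloballyMinimal] in
/-- **Inside `U`: `Φ(ρ̄ σ) · Φ(ρ̄(τστ⁻¹)) = ℓ·1`** at a good prime `ℓ ≠ p` with arithmetic Frobenius `σ ∈ U` and any
`τ ∉ U` (`y ȳ = det y = det ρ̄(Frob_ℓ) = ℓ`). [cite: Serre1972, §2.2] -/
theorem frob_mul_conj_eq_natCast_smul_one_of_mem (hk : IsField k) (e : geomTorsion W p ≃+ (Fin 2 → ZMod p))
    (he : ∀ (g : Multiplicative (AddAut (geomTorsion W p))) (x : geomTorsion W p),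
      e (Multiplicative.toAdd g x) = ((Φ g : GL (Fin 2) (ZMod p)) : Matrix (Fin 2) (Fin 2) (ZMod p)) *ᵥ e x)
    (hGN : (galoisRepTorsion W p).range.map Φ.toMonoidHom ≤
      Subgroup.normalizer (Serre1972.unitGroup k : Set (GL (Fin 2) (ZMod p))))
    {ℓ : ℕ} [Fact ℓ.Prime] (hℓp : ℓ ≠ p) (hgood : W.HasGoodReductionAtPrime ℓ)
    {v : HeightOneSpectrum (𝓞 ℚ)} (hv : (primesEquiv v : ℕ) = ℓ)
    {𝔓 : Ideal (absIntegers (𝓞 ℚ) ℚ)} (h𝔓 : 𝔓 ∈ v.primesAbove)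
    {σ τ : absoluteGaloisGroup ℚ} (hσF : IsArithFrobAt (𝓞 ℚ) σ 𝔓)
    (hσ : σ ∈ ((Serre1972.unitGroup k).comap Φ.toMonoidHom).comap (galoisRepTorsion W p))
    (hτ : τ ∉ ((Serre1972.unitGroup k).comap Φ.toMonoidHom).comap (galoisRepTorsion W p)) :
    ((Φ (galoisRepTorsion W p σ) : GL (Fin 2) (ZMod p)) : Matrix (Fin 2) (Fin 2) (ZMod p)) *
        ((Φ (galoisRepTorsion W p (τ * σ * τ⁻¹)) : GL (Fin 2) (ZMod p)) : Matrix (Fin 2) (Fin 2) (ZMod p)) =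
      (ℓ : ZMod p) • 1 := by
  have hy : ((Φ (galoisRepTorsion W p σ) : GL (Fin 2) (ZMod p)) : Matrix (Fin 2) (Fin 2) (ZMod p)) ∈ k := hσ
  rw [← det_frob_eq W p Φ e he hℓp hgood hv h𝔓 hσF, map_mul, map_mul, map_inv, map_mul, map_mul, map_inv,
    Units.val_mul, Units.val_mul, Matrix.coe_units_inv]
  exact mul_conj_eq_det_smul_one hk hy (frob_mem_normalizer W p Φ hGN τ) hτ

end Curve

/-! ### §3. The Frobenius values on `(ℓ)` -/

section Main

variable (W : WeierstrassCurve ℚ) [W.IsElliptic] [W.IsGloballyMinimal] (p : ℕ) [Fact p.Prime]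
  (Φ : Multiplicative (AddAut (geomTorsion W p)) ≃* GL (Fin 2) (ZMod p))
  {k : Subalgebra (ZMod p) (Matrix (Fin 2) (Fin 2) (ZMod p))}
  (K : Type) [Field K] [NumberField K] [IsGalois ℚ K]

omit [W.IsGloballyMinimal] in
/-- **`‖e⁻¹(χ̃ᵥ((ℓ))) − (d_K/ℓ)·ℓ‖ < 1`** for an odd good prime `ℓ ≠ p` of `E` with `ℓ ∤ d_K`, where
`χ̃ᵥ((ℓ)) = ∏_{w ∣ ℓ} χᵥ(w)` and `χᵥ(w) = e(T(j(Φρ̄(res Frob_w))))` at the `w ∣ ℓ`.  See the module docstring.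
[cite: Serre1972, §2.2] [cite: Ribet1977Nebentypus, §3 (p. 35)] -/
theorem norm_symm_idealPow_span_prime_sub_lt_one (hk : IsField k) (h2 : Module.finrank (ZMod p) k = 2)
    (eT : geomTorsion W p ≃+ (Fin 2 → ZMod p))
    (heT : ∀ (g : Multiplicative (AddAut (geomTorsion W p))) (x : geomTorsion W p),
      eT (Multiplicative.toAdd g x) = ((Φ g : GL (Fin 2) (ZMod p)) : Matrix (Fin 2) (Fin 2) (ZMod p)) *ᵥ eT x)
    (hGN : (galoisRepTorsion W p).range.map Φ.toMonoidHom ≤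
      Subgroup.normalizer (Serre1972.unitGroup k : Set (GL (Fin 2) (ZMod p))))
    (hK2 : Module.finrank ℚ K = 2)
    (hKU : ∀ τ : absoluteGaloisGroup K,
      Φ (galoisRepTorsion W p (absGaloisRestrict ℚ K τ)) ∈ Serre1972.unitGroup k)
    (hUK : ∀ σ : absoluteGaloisGroup ℚ,
      Φ (galoisRepTorsion W p σ) ∈ Serre1972.unitGroup k → σ ∈ (absGaloisRestrict ℚ K).range)
    (j : k →+* padicAlgClResidueField p) (e : PadicAlgCl p ≃+* ℂ)
    (T : padicAlgClResidueField p → padicAlgClIntegers p)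
    (hT : ∀ z, z ^ (p ^ 2 - 1) = 1 →
      (T z : PadicAlgCl p) ^ (p ^ 2 - 1) = 1 ∧ IsLocalRing.residue (padicAlgClIntegers p) (T z) = z)
    (hjpow : ∀ τ : absoluteGaloisGroup K,
      (j ⟨(Φ (galoisRepTorsion W p (absGaloisRestrict ℚ K τ)) : Matrix (Fin 2) (Fin 2) (ZMod p)), hKU τ⟩) ^
        (p ^ 2 - 1) = 1)
    (χv : HeightOneSpectrum (𝓞 K) → ℂ)
    {ℓ : ℕ} [Fact ℓ.Prime] (hℓp : ℓ ≠ p) (hℓ2 : ℓ ≠ 2) (hgood : W.HasGoodReductionAtPrime ℓ)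
    {v : HeightOneSpectrum (𝓞 ℚ)} (hv : (primesEquiv v : ℕ) = ℓ) (hℓd : ¬ (ℓ : ℤ) ∣ NumberField.discr K)
    (hχv : ∀ w : HeightOneSpectrum (𝓞 K), (ℓ : 𝓞 K) ∈ w.asIdeal →
      ∀ 𝔔 ∈ w.primesAbove, ∀ F : absoluteGaloisGroup K, IsArithFrobAt (𝓞 K) F 𝔔 →
        χv w = e (T (j ⟨(Φ (galoisRepTorsion W p (absGaloisRestrict ℚ K F)) : Matrix (Fin 2) (Fin 2) (ZMod p)),
          hKU F⟩))) :
    ‖e.symm (idealPow K χv (Ideal.span {(ℓ : 𝓞 K)})) -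
      (((ℓ : ℤ) * jacobiSym (NumberField.discr K) ℓ : ℤ) : PadicAlgCl p)‖ < 1 := by
  have hℓ : ℓ.Prime := Fact.out
  have hunr : Algebra.IsUnramifiedIn (𝓞 K) v.asIdeal := isUnramifiedIn_asIdeal_of_not_dvd_discr hv hℓd
  set H : Subgroup (absoluteGaloisGroup ℚ) := (absGaloisRestrict ℚ K).range with hHdef
  have hHn : H.Normal := normal_range_absGaloisRestrict ℚ K
  have hHi : H.index = Module.finrank ℚ K := index_range_absGaloisRestrict_eq_finrank ℚ K
  have hl : (Module.finrank ℚ K).Prime := by rw [hK2]; exact Nat.prime_two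
  have hmemH : ∀ σ : absoluteGaloisGroup ℚ, σ ∈ H ↔ Φ (galoisRepTorsion W p σ) ∈ Serre1972.unitGroup k := by
    intro σ
    refine ⟨?_, hUK σ⟩
    rintro ⟨τ, rfl⟩
    exact hKU τ
  have hmemU : ∀ σ : absoluteGaloisGroup ℚ,
      σ ∈ ((Serre1972.unitGroup k).comap Φ.toMonoidHom).comap (galoisRepTorsion W p) ↔
        Φ (galoisRepTorsion W p σ) ∈ Serre1972.unitGroup k := fun σ => Iff.rfl
  have hHtop : H ≠ ⊤ := by
    intro h
    rw [h, Subgroup.index_top, hK2] at hHi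
    exact absurd hHi (by norm_num)
  obtain ⟨c, hc⟩ : ∃ c : absoluteGaloisGroup ℚ, c ∉ H := by
    by_contra h
    push Not at h
    exact hHtop (eq_top_iff.mpr fun x _ => h x)
  obtain ⟨𝔓₀, h𝔓₀⟩ := v.primesAbove_nonempty
  obtain ⟨Fr, hFr⟩ := HeightOneSpectrum.exists_isArithFrobAt_of_mem_primesAbove_holds (K := ℚ) (v := v) h𝔓₀
  have hwv : ∀ w : HeightOneSpectrum (𝓞 K), w.under (𝓞 ℚ) = v ↔ (ℓ : 𝓞 K) ∈ w.asIdeal := fun w => by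
    rw [under_eq_iff_natCast_primesEquiv_mem, hv]
  -- `J = (d_K/ℓ) = ±1`
  have hcop : Nat.Coprime ℓ (NumberField.discr K).natAbs :=
    (Nat.Prime.coprime_iff_not_dvd hℓ).mpr fun h => hℓd (Int.natCast_dvd.mpr h)
  have hJ : jacobiSym (NumberField.discr K) ℓ = 1 ∨ jacobiSym (NumberField.discr K) ℓ = -1 :=
    jacobiSym.eq_one_or_neg_one (by rw [Int.gcd_eq_natAbs, Int.natAbs_natCast]; exact hcop.symm)
  rw [idealPow_span_natCast_eq_finprod hv hunr χv]
  by_cases hFrU : Φ (galoisRepTorsion W p Fr) ∈ Serre1972.unitGroup k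
  · /- `ℓ` split in `K`: two places, `(d_K/ℓ) = 1`, `χᵥ(w₀)χᵥ(w₁) ≡ ℓ` -/
    have hFrH : Fr ∈ H := (hmemH Fr).mpr hFrU
    obtain ⟨P, 𝔔, τ, hP, hf1, hcov, hinj⟩ :=
      exists_places_split_of_mem_range (F := ℚ) (M := K) hl hHn hHi hc hunr h𝔓₀ hFr hFrH
    rw [hK2] at hcov hinj
    have h01 : P 0 ≠ P 1 := fun h => absurd (hinj 0 (by norm_num) 1 (by norm_num) h) (by norm_num)
    have hS : {w : HeightOneSpectrum (𝓞 K) | (ℓ : 𝓞 K) ∈ w.asIdeal} = {P 0, P 1} := by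
      ext w
      simp only [Set.mem_setOf_eq, Set.mem_insert_iff, Set.mem_singleton_iff]
      constructor
      · intro hw
        obtain ⟨i, hi, hiw⟩ := hcov w ((hwv w).mpr hw)
        interval_cases i
        · exact Or.inl hiw.symm
        · exact Or.inr hiw.symm
      · rintro (rfl | rfl)
        · exact (hwv _).mp (hP 0).1
        · exact (hwv _).mp (hP 1).1
    rw [hS, finprod_mem_pair h01]
    -- `(d_K/ℓ) = 1`
    have hcard : Nat.card {w : HeightOneSpectrum (𝓞 K) // w.under (𝓞 ℚ) = v} = 2 := by
      rcases placesOver_dichotomy_of_prime (F := ℚ) (M := K) hl hunr with ⟨h, -⟩ | ⟨-, h⟩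
      · rw [h, hK2]
      · exfalso
        have := h (P 0) (hP 0).1
        rw [hf1 _ (hP 0).1, hK2] at this
        exact absurd this (by norm_num)
    have hJ1 : jacobiSym (NumberField.discr K) ℓ = 1 :=
      (natCard_placesOver_eq_two_iff_jacobiSym hK2 hv hℓ2).mp hcard
    rw [hJ1, mul_one, Int.cast_natCast]
    -- the two Frobenius values in `k` multiply to `ℓ`
    set y₀ : k := ⟨(Φ (galoisRepTorsion W p (absGaloisRestrict ℚ K (τ 0))) : Matrix (Fin 2) (Fin 2) (ZMod p)),
      hKU (τ 0)⟩ with hy₀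
    set y₁ : k := ⟨(Φ (galoisRepTorsion W p (absGaloisRestrict ℚ K (τ 1))) : Matrix (Fin 2) (Fin 2) (ZMod p)),
      hKU (τ 1)⟩ with hy₁
    have hres0 : absGaloisRestrict ℚ K (τ 0) = Fr := by
      rw [(hP 0).2.2.2.2, pow_zero, one_mul, inv_one, mul_one]
    have hres1 : absGaloisRestrict ℚ K (τ 1) = c * Fr * c⁻¹ := by
      rw [(hP 1).2.2.2.2, pow_one]
    have hcU : c ∉ ((Serre1972.unitGroup k).comap Φ.toMonoidHom).comap (galoisRepTorsion W p) := by
      rw [hmemU, ← hmemH]; exact hc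
    have hprod : y₀ * y₁ = ((ℓ : ℕ) : k) := by
      apply Subtype.ext
      rw [Subalgebra.coe_mul, SubringClass.coe_natCast, hy₀, hy₁, Subtype.coe_mk, Subtype.coe_mk, hres0, hres1,
        frob_mul_conj_eq_natCast_smul_one_of_mem W p Φ hk eT heT hGN hℓp hgood hv h𝔓₀ hFr
          ((hmemU Fr).mpr hFrU) hcU, Nat.cast_smul_eq_nsmul, Nat.smul_one_eq_cast]
    have hjprod : j y₀ * j y₁ = ((ℓ : ℕ) : padicAlgClResidueField p) := by
      rw [← map_mul, hprod, map_natCast]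
    set x₀ : padicAlgClIntegers p := T (j y₀) with hx₀
    set x₁ : padicAlgClIntegers p := T (j y₁) with hx₁
    have hx₀r : IsLocalRing.residue (padicAlgClIntegers p) x₀ = j y₀ := (hT _ (hjpow (τ 0))).2
    have hx₁r : IsLocalRing.residue (padicAlgClIntegers p) x₁ = j y₁ := (hT _ (hjpow (τ 1))).2
    have hχ0 : χv (P 0) = e (x₀ : PadicAlgCl p) :=
      hχv (P 0) ((hwv _).mp (hP 0).1) (𝔔 0) (hP 0).2.1 (τ 0) (hP 0).2.2.2.1
    have hχ1 : χv (P 1) = e (x₁ : PadicAlgCl p) :=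
      hχv (P 1) ((hwv _).mp (hP 1).1) (𝔔 1) (hP 1).2.1 (τ 1) (hP 1).2.2.2.1
    rw [hχ0, hχ1, ← map_mul, RingEquiv.symm_apply_apply]
    have h := norm_lt_one_of_residue_eq_zero (p := p) (x := x₀ * x₁ - ((ℓ : ℕ) : padicAlgClIntegers p))
      (by rw [map_sub, map_mul, hx₀r, hx₁r, hjprod, map_natCast, sub_self])
    push_cast at h
    exact h
  · /- `ℓ` inert in `K`: one place, `(d_K/ℓ) = -1`, `χᵥ(w) ≡ -ℓ` -/
    have hFrH : Fr ∉ H := fun h => hFrU ((hmemH Fr).mp h)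
    have hI : 𝔓₀.inertia (absoluteGaloisGroup ℚ) ≤ H := by
      intro σ hσ
      refine (hmemH σ).mpr ?_
      rw [galoisRepTorsion_eq_one_of_mem_inertia_prime (W := W) p hℓp hgood hv h𝔓₀ hσ, map_one]
      exact one_mem _
    obtain ⟨w, 𝔔, τ, hwv', huniq, hfw, h𝔔, -, hτF, hτres⟩ :=
      exists_place_inert_of_not_mem_range (F := ℚ) (M := K) hl hHn hHi hunr h𝔓₀ hI hFr hFrH
    rw [hK2] at hfw hτres
    have hS : {w' : HeightOneSpectrum (𝓞 K) | (ℓ : 𝓞 K) ∈ w'.asIdeal} = {w} := by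
      ext w'
      simp only [Set.mem_setOf_eq, Set.mem_singleton_iff]
      exact ⟨fun hw' => huniq w' ((hwv w').mpr hw'), fun h => h ▸ (hwv w).mp hwv'⟩
    rw [hS, finprod_mem_singleton]
    -- `(d_K/ℓ) = -1`
    have hcard : Nat.card {w' : HeightOneSpectrum (𝓞 K) // w'.under (𝓞 ℚ) = v} ≠ 2 := by
      rcases placesOver_dichotomy_of_prime (F := ℚ) (M := K) hl hunr with ⟨-, h⟩ | ⟨h, -⟩
      · exfalso
        have := h w hwv'
        rw [hfw] at this
        exact absurd this (by norm_num)
      · rw [h]; norm_num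
    have hJ1 : jacobiSym (NumberField.discr K) ℓ = -1 := by
      rcases hJ with h | h
      · exact absurd ((natCard_placesOver_eq_two_iff_jacobiSym hK2 hv hℓ2).mpr h) hcard
      · exact h
    rw [hJ1, mul_neg_one, Int.cast_neg, Int.cast_natCast, sub_neg_eq_add]
    -- the Frobenius value in `k` is `-ℓ`
    set y : k := ⟨(Φ (galoisRepTorsion W p (absGaloisRestrict ℚ K τ)) : Matrix (Fin 2) (Fin 2) (ZMod p)), hKU τ⟩
      with hy
    have hval : y = -((ℓ : ℕ) : k) := by
      apply Subtype.ext
      rw [Subalgebra.coe_neg, SubringClass.coe_natCast, hy, Subtype.coe_mk, hτres, pow_two,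
        frob_sq_eq_neg_smul_one_of_not_mem W p Φ hk h2 eT heT hGN hℓp hgood hv h𝔓₀ hFr
          (fun h => hFrU ((hmemU Fr).mp h)), Nat.cast_smul_eq_nsmul, Nat.smul_one_eq_cast]
    have hjval : j y = -((ℓ : ℕ) : padicAlgClResidueField p) := by rw [hval, map_neg, map_natCast]
    set x : padicAlgClIntegers p := T (j y) with hx
    have hxr : IsLocalRing.residue (padicAlgClIntegers p) x = j y := (hT _ (hjpow τ)).2
    have hχ : χv w = e (x : PadicAlgCl p) := hχv w ((hwv _).mp hwv') 𝔔 h𝔔 τ hτF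
    rw [hχ, RingEquiv.symm_apply_apply]
    have h := norm_lt_one_of_residue_eq_zero (p := p) (x := x + ((ℓ : ℕ) : padicAlgClIntegers p))
      (by rw [map_add, hxr, hjval, map_natCast, neg_add_cancel])
    push_cast at h
    exact h

end Main

end Summit.BirchSwinnertonDyer.BirchSwinnertonDyer.Theorems.SmallImageLambdaLowerThreeNsThetaPartner

end
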